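import Summits.CriticalPhenomena.Ising3DConformalLimit.Theses.LongRangeEndpoint

/-!
# Birth skeleton of leaf `EndpointModulus` (split of `EndpointContinuity`, stmt-CriticalPhenomena-11274)

≥ 2 named stubs + `EndpointModulus_of : <stubs> → EndpointModulus` (leaf statement verbatim = children.json); sorries only
inside `stub_*`. crux-strategist planner-cstrat-stmt-CriticalPhenomena-11274-r1-0, 2026-08-17.
-/

namespace Summit.CriticalPhenomena.Ising3DConformalLimit.Cruxes.EndpointContinuity.EndpointModulusBirth

open scoped BigOperators Topology Classical
open Filter Set
open Literature.Probability.LatticeModels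

/-- STUB (leaf 1a, interior regularity): the normalised LR data are differentiable in the exponent α on the whole protected window, configuration by configuration (smooth dependence of the long-range fixed point on s inside the window; lattice handle: ∂_α⟨σ_A⟩ = integrated truncated correlations against ∂_α J_α). -/
theorem stub_differentiableOnWindow :
    open Literature.Probability.LatticeModels in let J : ℝ → Site 3 → Site 3 → ℝ := fun a x y => if x = y then (0 : ℝ) else -(((2 * Real.pi) ^ 3)⁻¹ * ∫ k in Set.pi Set.univ (fun _ : Fin 3 => Set.Icc (-Real.pi) Real.pi), (2 * ∑ i, (1 - Real.cos (k i))) ^ (a / 2) * Real.cos (∑ j, k j * ((x j : ℝ) - (y j : ℝ)))); let st : ℝ → ℝ → ℝ → (SpinConfig (Site 3) → ℝ) → ℝ := fun a β h F => limUnder atTop (fun L : ℕ => let Λ := box 3 L; let w : (↥Λ → ℤˣ) → ℝ := fun τ => Real.exp (-β * (-(∑ x ∈ Λ, ∑ y ∈ Λ, J a x y * spinAt x (glue Λ τ .free) * spinAt y (glue Λ τ .free)) / 2 - h * ∑ x ∈ Λ, spinAt x (glue Λ τ .free))); (∑ τ, F (glue Λ τ .free) * w τ) / ∑ τ, w τ);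 let βc : ℝ → ℝ := fun a => sInf {β : ℝ | 0 < β ∧ 0 < limUnder (𝓝[>] (0 : ℝ)) (fun h : ℝ => st a β h (spinAt 0))}; let G : ℝ → Site 3 → ℝ := fun a x => st a (βc a) 0 (fun σ => spinAt 0 σ * spinAt x σ); let corr : ℝ → (n : ℕ) → (Fin n → Site 3) → ℝ := fun a _ y => st a (βc a) 0 (spinMonomial y); let Prot : ℝ → Prop := fun b => ∃ c C : ℝ, 0 < c ∧ ∀ x : Site 3, x ≠ 0 → c / ‖x‖ ^ ((3 : ℝ) - b) ≤ G b x ∧ G b x ≤ C / ‖x‖ ^ ((3 : ℝ) - b); ∀ αs : ℝ, IsLUB {a : ℝ | a ≤ 2 ∧ ∀ b ∈ Set.Ioo (3 / 2 : ℝ) a, Prot b} αs → 3 / 2 < αs → ∀ S : ℝ → CorrFamily 3, (∀ a ∈ Set.Ioo (3 / 2 : ℝ) αs, (∃ ρ : ℝ → ℝ, (∀ δ ∈ Set.Ioc (0 : ℝ) 1, 0 < ρ δ) ∧ HasPointwiseScalingLimit (corr a) ρ (S a)) ∧ S a 2 ![0, (EuclideanSpace.single (0 : Fin 3) (1 : ℝ))]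 = 1 ∧ (∀ (n : ℕ) (z : Fin n → EuclideanSpace ℝ (Fin 3)), z ∉ NonCoincident 3 n → S a n z = 0)) → ∀ (n : ℕ) (z : Fin n → EuclideanSpace ℝ (Fin 3)), DifferentiableOn ℝ (fun a : ℝ => S a n z) (Set.Ioo (3 / 2 : ℝ) αs) := by
  sorry

/-- STUB (leaf 1b, no blow-up at the crossover): that α-derivative stays bounded on a left neighbourhood of αs (BRRZ: σ-data are power series in g_*² ∝ αs − α, so ∂_α data → finite limit; fails if √(αs−α) or 1/log terms appear). `deriv` is junk (0) where non-differentiable — leaf 1a supplies differentiability. -/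
theorem stub_derivBoundedNearEndpoint :
    open Literature.Probability.LatticeModels in let J : ℝ → Site 3 → Site 3 → ℝ := fun a x y => if x = y then (0 : ℝ) else -(((2 * Real.pi) ^ 3)⁻¹ * ∫ k in Set.pi Set.univ (fun _ : Fin 3 => Set.Icc (-Real.pi) Real.pi), (2 * ∑ i, (1 - Real.cos (k i))) ^ (a / 2) * Real.cos (∑ j, k j * ((x j : ℝ) - (y j : ℝ)))); let st : ℝ → ℝ → ℝ → (SpinConfig (Site 3) → ℝ) → ℝ := fun a β h F => limUnder atTop (fun L : ℕ => let Λ := box 3 L; let w : (↥Λ → ℤˣ) → ℝ := fun τ => Real.exp (-β * (-(∑ x ∈ Λ, ∑ y ∈ Λ, J a x y * spinAt x (glue Λ τ .free) * spinAt y (glue Λ τ .free)) / 2 - h * ∑ x ∈ Λ, spinAt x (glue Λ τ .free))); (∑ τ, F (glue Λ τ .free) * w τ) / ∑ τ, w τ); let βc : ℝ → ℝ := fun a => sInf {β : ℝ | 0 < β ∧ 0 < limUnder (𝓝[>] (0 : ℝ)) (fun h : ℝ => st a β h (spinAt 0))}; let G : ℝ → Site 3 → ℝ := fun a x => st a (βc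 a) 0 (fun σ => spinAt 0 σ * spinAt x σ); let corr : ℝ → (n : ℕ) → (Fin n → Site 3) → ℝ := fun a _ y => st a (βc a) 0 (spinMonomial y); let Prot : ℝ → Prop := fun b => ∃ c C : ℝ, 0 < c ∧ ∀ x : Site 3, x ≠ 0 → c / ‖x‖ ^ ((3 : ℝ) - b) ≤ G b x ∧ G b x ≤ C / ‖x‖ ^ ((3 : ℝ) - b); ∀ αs : ℝ, IsLUB {a : ℝ | a ≤ 2 ∧ ∀ b ∈ Set.Ioo (3 / 2 : ℝ) a, Prot b} αs → 3 / 2 < αs → ∀ S : ℝ → CorrFamily 3, (∀ a ∈ Set.Ioo (3 / 2 : ℝ) αs, (∃ ρ : ℝ → ℝ, (∀ δ ∈ Set.Ioc (0 : ℝ) 1, 0 < ρ δ) ∧ HasPointwiseScalingLimit (corr a) ρ (S a)) ∧ S a 2 ![0, (EuclideanSpace.single (0 : Fin 3) (1 : ℝ))] = 1 ∧ (∀ (n : ℕ) (z : Fin n → EuclideanSpace ℝ (Fin 3)), z ∉ NonCoincident 3 n → S a n z = 0)) → ∀ (n : ℕ) (z : Fin n → EuclideanSpace ℝ (Fin 3)),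 ∃ ε : ℝ, 0 < ε ∧ ∃ M : ℝ, ∀ a ∈ Set.Ioo (αs - ε) αs, |deriv (fun a : ℝ => S a n z) a| ≤ M := by
  sorry

/-- A Hölder-type modulus of continuity on a left neighbourhood of `αs` forces the left limit at
`αs` to exist (Cauchy criterion in the complete space `ℝ`). [folklore] -/
theorem exists_tendsto_of_modulus {αs : ℝ} {f : ℝ → ℝ}
    (h : ∃ ε : ℝ, 0 < ε ∧ ∃ C θ : ℝ, 0 < θ ∧ ∀ a ∈ Set.Ioo (αs - ε) αs, ∀ a' ∈ Set.Ioo (αs - ε) αs,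
      |f a - f a'| ≤ C * |a - a'| ^ θ) :
    ∃ t : ℝ, Tendsto f (𝓝[<] αs) (𝓝 t) := by
  obtain ⟨ε, hε, C, θ, hθ, hmod⟩ := h
  rw [← cauchy_map_iff_exists_tendsto]
  refine Metric.cauchy_iff.2 ⟨Filter.map_neBot, fun e he => ?_⟩
  -- the effective constant `C' = max C 0 ≥ 0`
  set C' : ℝ := max C 0 with hC'
  have hC'0 : 0 ≤ C' := le_max_right _ _
  have hCC' : C ≤ C' := le_max_left _ _
  -- choose `η₀ > 0` with `C' * η₀ ^ θ < e`
  set q : ℝ := e / (2 * (C' + 1)) with hq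
  have hq0 : 0 < q := by
    have : 0 < 2 * (C' + 1) := by positivity
    exact div_pos he this
  set η₀ : ℝ := q ^ θ⁻¹ with hη₀
  have hη₀0 : 0 < η₀ := Real.rpow_pos_of_pos hq0 _
  have hη₀θ : η₀ ^ θ = q := by
    rw [hη₀, Real.rpow_inv_rpow hq0.le hθ.ne']
  have hsmall : C' * η₀ ^ θ < e := by
    rw [hη₀θ, hq]
    have h1 : C' * (e / (2 * (C' + 1))) = e * (C' / (2 * (C' + 1))) := by ring
    rw [h1]
    have h2 : C' / (2 * (C' + 1)) < 1 := by
      rw [div_lt_one (by positivity)]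
      linarith
    calc e * (C' / (2 * (C' + 1))) < e * 1 := by
          exact mul_lt_mul_of_pos_left h2 he
      _ = e := mul_one e
  -- the set `f '' Ioo (αs - η) αs` belongs to the mapped filter and has diameter `< e`
  set η : ℝ := min ε η₀ with hη
  have hη0 : 0 < η := lt_min hε hη₀0
  have hηε : η ≤ ε := min_le_left _ _
  have hηη₀ : η ≤ η₀ := min_le_right _ _
  refine ⟨f '' Set.Ioo (αs - η) αs, image_mem_map (Ioo_mem_nhdsLT (by linarith)), ?_⟩
  rintro x ⟨a, ha, rfl⟩ y ⟨a', ha', rfl⟩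
  have haε : a ∈ Set.Ioo (αs - ε) αs := ⟨by linarith [ha.1], ha.2⟩
  have ha'ε : a' ∈ Set.Ioo (αs - ε) αs := ⟨by linarith [ha'.1], ha'.2⟩
  have hdist : |a - a'| ≤ η₀ := by
    rw [abs_sub_le_iff]
    constructor <;> linarith [ha.1, ha.2, ha'.1, ha'.2]
  have hpow : |a - a'| ^ θ ≤ η₀ ^ θ :=
    Real.rpow_le_rpow (abs_nonneg _) hdist hθ.le
  have hpow0 : 0 ≤ |a - a'| ^ θ := Real.rpow_nonneg (abs_nonneg _) _
  rw [Real.dist_eq]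
  calc |f a - f a'| ≤ C * |a - a'| ^ θ := hmod a haε a' ha'ε
    _ ≤ C' * |a - a'| ^ θ := mul_le_mul_of_nonneg_right hCC' hpow0
    _ ≤ C' * η₀ ^ θ := mul_le_mul_of_nonneg_left hpow hC'0
    _ < e := hsmall

/-- **Core of the split.** For a one-parameter family `S : ℝ → CorrFamily 3` and an endpoint `αs`:
a Hölder modulus in the parameter on a left neighbourhood of `αs` (every `n`, every configuration),
a two-point floor near `αs` on non-coincident pairs, and a floor for `|U₄|` near `αs` at one
non-coincident quadruple together produce an endpoint family `T` — the pointwise left limit —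
which is non-degenerate and non-Gaussian. `T` is CONSTRUCTED here (completeness of `ℝ`), and its
two properties are obtained by passing the uniform pre-limit bounds through the limit
(`ge_of_tendsto`, continuity of the Ursell polynomial `limitConnectedFour`). [folklore] -/
theorem core {αs : ℝ} {S : ℝ → CorrFamily 3}
    (h1 : ∀ (n : ℕ) (z : Fin n → EuclideanSpace ℝ (Fin 3)), ∃ ε : ℝ, 0 < ε ∧ ∃ C θ : ℝ, 0 < θ ∧
      ∀ a ∈ Set.Ioo (αs - ε) αs, ∀ a' ∈ Set.Ioo (αs - ε) αs, |S a n z - S a' n z| ≤ C * |a - a'| ^ θ)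
    (h2 : ∀ x ∈ NonCoincident 3 2, ∃ c : ℝ, 0 < c ∧ ∃ ε : ℝ, 0 < ε ∧
      ∀ a ∈ Set.Ioo (αs - ε) αs, c ≤ S a 2 x)
    (h3 : ∃ x ∈ NonCoincident 3 4, ∃ c : ℝ, 0 < c ∧ ∃ ε : ℝ, 0 < ε ∧
      ∀ a ∈ Set.Ioo (αs - ε) αs, c ≤ |limitConnectedFour (S a) x|) :
    ∃ T : CorrFamily 3,
      (∀ (n : ℕ) (z : Fin n → EuclideanSpace ℝ (Fin 3)),
        Filter.Tendsto (fun a : ℝ => S a n z) (𝓝[<] αs) (𝓝 (T n z))) ∧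
      IsNondegenerateTwoPoint T ∧ HasNontrivialU4 T := by
  -- (1) the endpoint family, configuration by configuration, from the modulus
  choose T hT using fun (n : ℕ) (z : Fin n → EuclideanSpace ℝ (Fin 3)) =>
    exists_tendsto_of_modulus (h1 n z)
  refine ⟨T, hT, ?_, ?_⟩
  · -- (2) non-degeneracy: the uniform two-point floor survives the limit
    intro x hx
    obtain ⟨c, hc, ε, hε, hfloor⟩ := h2 x hx
    have hev : ∀ᶠ a in 𝓝[<] αs, c ≤ S a 2 x :=
      mem_of_superset (Ioo_mem_nhdsLT (by linarith)) fun a ha => hfloor a ha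
    exact lt_of_lt_of_le hc (ge_of_tendsto (hT 2 x) hev)
  · -- (3) non-Gaussianity: `U₄(S a) x → U₄(T) x` and the floor on `|U₄|` survives the limit
    obtain ⟨x, hx, c, hc, ε, hε, hfloor⟩ := h3
    refine ⟨x, hx, ?_⟩
    have hlim : Filter.Tendsto (fun a : ℝ => limitConnectedFour (S a) x) (𝓝[<] αs)
        (𝓝 (limitConnectedFour T x)) := by
      unfold limitConnectedFour
      exact (hT 4 x).sub ((((hT 2 _).mul (hT 2 _)).add ((hT 2 _).mul (hT 2 _))).add
        ((hT 2 _).mul (hT 2 _)))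
    have hev : ∀ᶠ a in 𝓝[<] αs, c ≤ |limitConnectedFour (S a) x| :=
      mem_of_superset (Ioo_mem_nhdsLT (by linarith)) fun a ha => hfloor a ha
    have habs : c ≤ |limitConnectedFour T x| :=
      ge_of_tendsto ((continuous_abs.tendsto _).comp hlim) hev
    intro h0
    rw [h0, abs_zero] at habs
    exact absurd habs (not_le.mpr hc)



/-- Mean-value step (leaf 1): differentiability on the window plus a bounded derivative on a left
neighbourhood of `αs` give a Lipschitz (= Hölder, θ = 1) modulus there. [folklore] -/
theorem modulus_of_deriv {αs : ℝ} (hαs : 3 / 2 < αs) {f : ℝ → ℝ}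
    (hd : DifferentiableOn ℝ f (Set.Ioo (3 / 2 : ℝ) αs))
    (hb : ∃ ε : ℝ, 0 < ε ∧ ∃ M : ℝ, ∀ a ∈ Set.Ioo (αs - ε) αs, |deriv f a| ≤ M) :
    ∃ ε : ℝ, 0 < ε ∧ ∃ C θ : ℝ, 0 < θ ∧ ∀ a ∈ Set.Ioo (αs - ε) αs, ∀ a' ∈ Set.Ioo (αs - ε) αs,
      |f a - f a'| ≤ C * |a - a'| ^ θ := by
  obtain ⟨ε, hε, M, hM⟩ := hb
  refine ⟨min ε (αs - 3 / 2), lt_min hε (by linarith), M, 1, one_pos, ?_⟩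
  intro a ha a' ha'
  have hmin1 : min ε (αs - 3 / 2) ≤ ε := min_le_left _ _
  have hmin2 : min ε (αs - 3 / 2) ≤ αs - 3 / 2 := min_le_right _ _
  have hsub1 : Set.Ioo (αs - min ε (αs - 3 / 2)) αs ⊆ Set.Ioo (3 / 2 : ℝ) αs := fun b hb =>
    ⟨by linarith [hb.1], hb.2⟩
  have hsub2 : Set.Ioo (αs - min ε (αs - 3 / 2)) αs ⊆ Set.Ioo (αs - ε) αs := fun b hb =>
    ⟨by linarith [hb.1], hb.2⟩
  have hdiff : ∀ b ∈ Set.Ioo (αs - min ε (αs - 3 / 2)) αs, DifferentiableAt ℝ f b := fun b hb =>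
    hd.differentiableAt (Ioo_mem_nhds (hsub1 hb).1 (hsub1 hb).2)
  have hbound : ∀ b ∈ Set.Ioo (αs - min ε (αs - 3 / 2)) αs, ‖deriv f b‖ ≤ M := fun b hb => by
    rw [Real.norm_eq_abs]; exact hM b (hsub2 hb)
  have key := (convex_Ioo (αs - min ε (αs - 3 / 2)) αs).norm_image_sub_le_of_norm_deriv_le
    hdiff hbound ha' ha
  rw [Real.norm_eq_abs, Real.norm_eq_abs] at key
  rw [Real.rpow_one]
  exact key

/-- Floor step (leaf 2): the exact protected two-point law `S a 2 x = ‖x₀ − x₁‖^(a−3)` on the window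
`(3/2, αs)`, `αs ≤ 2`, is bounded below by `min 1 (‖x₀ − x₁‖^(−3/2))` uniformly in `a`. [folklore] -/
theorem floor_of_twoPointLaw {αs : ℝ} (hαs : 3 / 2 < αs) (hαs2 : αs ≤ 2) {S : ℝ → CorrFamily 3}
    (hlaw : ∀ a ∈ Set.Ioo (3 / 2 : ℝ) αs, ∀ x ∈ NonCoincident 3 2,
      S a 2 x = ‖x 0 - x 1‖ ^ (-(2 * ((3 - a) / 2)))) :
    ∀ x ∈ NonCoincident 3 2, ∃ c : ℝ, 0 < c ∧ ∃ ε : ℝ, 0 < ε ∧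
      ∀ a ∈ Set.Ioo (αs - ε) αs, c ≤ S a 2 x := by
  intro x hx
  have hinj : Function.Injective x := hx
  have hne : x 0 ≠ x 1 := fun h => absurd (hinj h) (by decide)
  have hr : 0 < ‖x 0 - x 1‖ := norm_pos_iff.2 (sub_ne_zero.2 hne)
  refine ⟨min 1 (‖x 0 - x 1‖ ^ (-(3 / 2 : ℝ))), lt_min one_pos (Real.rpow_pos_of_pos hr _),
    αs - 3 / 2, by linarith, ?_⟩
  intro a ha
  have ha' : a ∈ Set.Ioo (3 / 2 : ℝ) αs := ⟨by linarith [ha.1], ha.2⟩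
  rw [hlaw a ha' x hx]
  have he : -(2 * ((3 - a) / 2)) = a - 3 := by ring
  rw [he]
  rcases le_or_gt 1 ‖x 0 - x 1‖ with h1 | h1
  · calc min 1 (‖x 0 - x 1‖ ^ (-(3 / 2 : ℝ))) ≤ ‖x 0 - x 1‖ ^ (-(3 / 2 : ℝ)) := min_le_right _ _
      _ ≤ ‖x 0 - x 1‖ ^ (a - 3) := Real.rpow_le_rpow_of_exponent_le h1 (by linarith [ha'.1])
  · calc min 1 (‖x 0 - x 1‖ ^ (-(3 / 2 : ℝ))) ≤ 1 := min_le_left _ _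
      _ = ‖x 0 - x 1‖ ^ (0 : ℝ) := (Real.rpow_zero _).symm
      _ ≤ ‖x 0 - x 1‖ ^ (a - 3) :=
        Real.rpow_le_rpow_of_exponent_ge hr h1.le (by linarith [ha'.2])

/-- Floor step (leaf 3): a real function converging along `𝓝[<] αs` to a non-zero value is bounded
away from `0` in absolute value on a left neighbourhood of `αs`. [folklore] -/
theorem absFloor_of_tendsto {αs : ℝ} {g : ℝ → ℝ} {u : ℝ}
    (hg : Filter.Tendsto g (𝓝[<] αs) (𝓝 u)) (hu : u ≠ 0) :
    ∃ c : ℝ, 0 < c ∧ ∃ ε : ℝ, 0 < ε ∧ ∀ a ∈ Set.Ioo (αs - ε) αs, c ≤ |g a| := by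
  have hpos : 0 < |u| := abs_pos.2 hu
  have hev : ∀ᶠ a in 𝓝[<] αs, |u| / 2 < |g a| :=
    ((continuous_abs.tendsto u).comp hg).eventually (lt_mem_nhds (by linarith))
  obtain ⟨l, hl, hsub⟩ := mem_nhdsLT_iff_exists_Ioo_subset.1 hev
  refine ⟨|u| / 2, by linarith, αs - l, by simpa using hl, fun a ha => ?_⟩
  have ha' : a ∈ Set.Ioo l αs := ⟨by linarith [ha.1], ha.2⟩
  exact le_of_lt (hsub ha')

/-- Algebra step: pointwise convergence of `S · n z` for all `n, z` gives convergence of the Ursell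
function `U₄(S ·) x`. [folklore] -/
theorem u4_tendsto {αs : ℝ} {S : ℝ → CorrFamily 3} {T : CorrFamily 3}
    (hT : ∀ (n : ℕ) (z : Fin n → EuclideanSpace ℝ (Fin 3)),
      Filter.Tendsto (fun a : ℝ => S a n z) (𝓝[<] αs) (𝓝 (T n z)))
    (x : Fin 4 → EuclideanSpace ℝ (Fin 3)) :
    Filter.Tendsto (fun a : ℝ => limitConnectedFour (S a) x) (𝓝[<] αs)
      (𝓝 (limitConnectedFour T x)) := by
  unfold limitConnectedFour
  exact (hT 4 x).sub ((((hT 2 _).mul (hT 2 _)).add ((hT 2 _).mul (hT 2 _))).add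
    ((hT 2 _).mul (hT 2 _)))

/-- Leaf 1 from its two stubs (mean value theorem). [folklore] -/
theorem EndpointModulus_of :
    (open Literature.Probability.LatticeModels in let J : ℝ → Site 3 → Site 3 → ℝ := fun a x y => if x = y then (0 : ℝ) else -(((2 * Real.pi) ^ 3)⁻¹ * ∫ k in Set.pi Set.univ (fun _ : Fin 3 => Set.Icc (-Real.pi) Real.pi), (2 * ∑ i, (1 - Real.cos (k i))) ^ (a / 2) * Real.cos (∑ j, k j * ((x j : ℝ) - (y j : ℝ)))); let st : ℝ → ℝ → ℝ → (SpinConfig (Site 3) → ℝ) → ℝ := fun a β h F => limUnder atTop (fun L : ℕ => let Λ := box 3 L; let w : (↥Λ → ℤˣ) → ℝ := fun τ => Real.exp (-β * (-(∑ x ∈ Λ, ∑ y ∈ Λ, J a x y * spinAt x (glue Λ τ .free) * spinAt y (glue Λ τ .free)) / 2 - h * ∑ x ∈ Λ, spinAt x (glue Λ τ .free))); (∑ τ, F (glue Λ τ .free) * w τ) / ∑ τ, w τ); let βc : ℝ → ℝ := fun a => sInf {β : ℝ | 0 < β ∧ 0 < limUnder (𝓝[>] (0 : ℝ)) (fun h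 : ℝ => st a β h (spinAt 0))}; let G : ℝ → Site 3 → ℝ := fun a x => st a (βc a) 0 (fun σ => spinAt 0 σ * spinAt x σ); let corr : ℝ → (n : ℕ) → (Fin n → Site 3) → ℝ := fun a _ y => st a (βc a) 0 (spinMonomial y); let Prot : ℝ → Prop := fun b => ∃ c C : ℝ, 0 < c ∧ ∀ x : Site 3, x ≠ 0 → c / ‖x‖ ^ ((3 : ℝ) - b) ≤ G b x ∧ G b x ≤ C / ‖x‖ ^ ((3 : ℝ) - b); ∀ αs : ℝ, IsLUB {a : ℝ | a ≤ 2 ∧ ∀ b ∈ Set.Ioo (3 / 2 : ℝ) a, Prot b} αs → 3 / 2 < αs → ∀ S : ℝ → CorrFamily 3, (∀ a ∈ Set.Ioo (3 / 2 : ℝ) αs, (∃ ρ : ℝ → ℝ, (∀ δ ∈ Set.Ioc (0 : ℝ) 1, 0 < ρ δ) ∧ HasPointwiseScalingLimit (corr a) ρ (S a)) ∧ S a 2 ![0, (EuclideanSpace.single (0 : Fin 3) (1 : ℝ))] = 1 ∧ (∀ (n : ℕ) (z : Fin n → EuclideanSpace ℝ (Fin 3)), z ∉ NonCoincident 3 n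 → S a n z = 0)) → ∀ (n : ℕ) (z : Fin n → EuclideanSpace ℝ (Fin 3)), DifferentiableOn ℝ (fun a : ℝ => S a n z) (Set.Ioo (3 / 2 : ℝ) αs)) →
    (open Literature.Probability.LatticeModels in let J : ℝ → Site 3 → Site 3 → ℝ := fun a x y => if x = y then (0 : ℝ) else -(((2 * Real.pi) ^ 3)⁻¹ * ∫ k in Set.pi Set.univ (fun _ : Fin 3 => Set.Icc (-Real.pi) Real.pi), (2 * ∑ i, (1 - Real.cos (k i))) ^ (a / 2) * Real.cos (∑ j, k j * ((x j : ℝ) - (y j : ℝ)))); let st : ℝ → ℝ → ℝ → (SpinConfig (Site 3) → ℝ) → ℝ := fun a β h F => limUnder atTop (fun L : ℕ => let Λ := box 3 L; let w : (↥Λ → ℤˣ) → ℝ := fun τ => Real.exp (-β * (-(∑ x ∈ Λ, ∑ y ∈ Λ, J a x y * spinAt x (glue Λ τ .free) * spinAt y (glue Λ τ .free)) / 2 - h * ∑ x ∈ Λ, spinAt x (glue Λ τ .free))); (∑ τ, F (glue Λ τ .free) * w τ) / ∑ τ, w τ); let βc : ℝ → ℝ := fun a => sInf {β : ℝ | 0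 < β ∧ 0 < limUnder (𝓝[>] (0 : ℝ)) (fun h : ℝ => st a β h (spinAt 0))}; let G : ℝ → Site 3 → ℝ := fun a x => st a (βc a) 0 (fun σ => spinAt 0 σ * spinAt x σ); let corr : ℝ → (n : ℕ) → (Fin n → Site 3) → ℝ := fun a _ y => st a (βc a) 0 (spinMonomial y); let Prot : ℝ → Prop := fun b => ∃ c C : ℝ, 0 < c ∧ ∀ x : Site 3, x ≠ 0 → c / ‖x‖ ^ ((3 : ℝ) - b) ≤ G b x ∧ G b x ≤ C / ‖x‖ ^ ((3 : ℝ) - b); ∀ αs : ℝ, IsLUB {a : ℝ | a ≤ 2 ∧ ∀ b ∈ Set.Ioo (3 / 2 : ℝ) a, Prot b} αs → 3 / 2 < αs → ∀ S : ℝ → CorrFamily 3, (∀ a ∈ Set.Ioo (3 / 2 : ℝ) αs, (∃ ρ : ℝ → ℝ, (∀ δ ∈ Set.Ioc (0 : ℝ) 1, 0 < ρ δ) ∧ HasPointwiseScalingLimit (corr a) ρ (S a)) ∧ S a 2 ![0, (EuclideanSpace.single (0 : Fin 3) (1 : ℝ))] = 1 ∧ (∀ (n : ℕ) (z : Fin n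 → EuclideanSpace ℝ (Fin 3)), z ∉ NonCoincident 3 n → S a n z = 0)) → ∀ (n : ℕ) (z : Fin n → EuclideanSpace ℝ (Fin 3)), ∃ ε : ℝ, 0 < ε ∧ ∃ M : ℝ, ∀ a ∈ Set.Ioo (αs - ε) αs, |deriv (fun a : ℝ => S a n z) a| ≤ M) →
    (open Literature.Probability.LatticeModels in let J : ℝ → Site 3 → Site 3 → ℝ := fun a x y => if x = y then (0 : ℝ) else -(((2 * Real.pi) ^ 3)⁻¹ * ∫ k in Set.pi Set.univ (fun _ : Fin 3 => Set.Icc (-Real.pi) Real.pi), (2 * ∑ i, (1 - Real.cos (k i))) ^ (a / 2) * Real.cos (∑ j, k j * ((x j : ℝ) - (y j : ℝ)))); let st : ℝ → ℝ → ℝ → (SpinConfig (Site 3) → ℝ) → ℝ := fun a β h F => limUnder atTop (fun L : ℕ => let Λ := box 3 L; let w : (↥Λ → ℤˣ) → ℝ := fun τ => Real.exp (-β * (-(∑ x ∈ Λ, ∑ y ∈ Λ, J a x y * spinAt x (glue Λ τ .free) * spinAt y (glue Λ τ .free)) / 2 - h * ∑ x ∈ Λ, spinAt x (glue Λ τ .free)));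 (∑ τ, F (glue Λ τ .free) * w τ) / ∑ τ, w τ); let βc : ℝ → ℝ := fun a => sInf {β : ℝ | 0 < β ∧ 0 < limUnder (𝓝[>] (0 : ℝ)) (fun h : ℝ => st a β h (spinAt 0))}; let G : ℝ → Site 3 → ℝ := fun a x => st a (βc a) 0 (fun σ => spinAt 0 σ * spinAt x σ); let corr : ℝ → (n : ℕ) → (Fin n → Site 3) → ℝ := fun a _ y => st a (βc a) 0 (spinMonomial y); let Prot : ℝ → Prop := fun b => ∃ c C : ℝ, 0 < c ∧ ∀ x : Site 3, x ≠ 0 → c / ‖x‖ ^ ((3 : ℝ) - b) ≤ G b x ∧ G b x ≤ C / ‖x‖ ^ ((3 : ℝ) - b); ∀ αs : ℝ, IsLUB {a : ℝ | a ≤ 2 ∧ ∀ b ∈ Set.Ioo (3 / 2 : ℝ) a, Prot b} αs → 3 / 2 < αs → ∀ S : ℝ → CorrFamily 3, (∀ a ∈ Set.Ioo (3 / 2 : ℝ) αs, (∃ ρ : ℝ → ℝ, (∀ δ ∈ Set.Ioc (0 : ℝ) 1, 0 < ρ δ) ∧ HasPointwiseScalingLimit (corr a) ρ (S a)) ∧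 S a 2 ![0, (EuclideanSpace.single (0 : Fin 3) (1 : ℝ))] = 1 ∧ (∀ (n : ℕ) (z : Fin n → EuclideanSpace ℝ (Fin 3)), z ∉ NonCoincident 3 n → S a n z = 0)) → ∀ (n : ℕ) (z : Fin n → EuclideanSpace ℝ (Fin 3)), ∃ ε : ℝ, 0 < ε ∧ ∃ C θ : ℝ, 0 < θ ∧ ∀ a ∈ Set.Ioo (αs - ε) αs, ∀ a' ∈ Set.Ioo (αs - ε) αs, |S a n z - S a' n z| ≤ C * |a - a'| ^ θ) := by
  intro s1 s2 J st βc G corr Prot αs hlub hαs S hS n z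
  exact modulus_of_deriv hαs (s1 αs hlub hαs S hS n z) (s2 αs hlub hαs S hS n z)

end Summit.CriticalPhenomena.Ising3DConformalLimit.Cruxes.EndpointContinuity.EndpointModulusBirth
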